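import Mathlib

/-!
# SoloInformed — continuous leaf sections from a time function (order-theoretic core of CAPS LEMMA A, Step 4)

Soloist `solo-FinalStateConjecture-informed`, session 27 (2026-08-19). Pure order/topology, no geometry
imported: the kernel shadow of Step 4 of LEMMA A (`paper/CAPS.md` §2) and of its chart-by-chart form
(§8.3). Dictionary. `Y` = the compact piece `N″` of the cap, `c y : ℝ → M` = the comoving worldline
through `y`, `f : M → ℝ` = the chart time (`x⁰ ∘ Ψ₀⁻¹`, or `t* ∘ (chart i)⁻¹`), a TIME FUNCTION along the
congruence: `t ↦ f (c y t)` is continuous, strictly increasing and unbounded above (Step 3), jointly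
continuous in `(y, t)`, and below the level `σ` at the initial time `t₁`. Then:

* `exists_crossing` / `crossing_unique` — each worldline meets the leaf `{f = σ}` exactly once after `t₁`;
* `continuous_crossing` — the crossing time `tσ : Y → ℝ` is continuous (no differentiability needed:
  strict monotonicity replaces the implicit function theorem);
* `continuous_leafSection`, `leafSection_level`, `leafSection_injective` — `y ↦ c y (tσ y)` is a
  continuous injection of `Y` into the leaf `{f = σ}` when distinct worldlines are disjoint;
* `isClosedEmbedding_leafSection` — for compact `Y` and Hausdorff `M` it is a closed embedding, i.e.
  a homeomorphic copy `Λ_σ ≅ Y` inside ONE leaf (the input to Step 5: `Y ∖ ball ↪ {x⁰ = σ} ≅ ℝ³`).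

[folklore]
-/

noncomputable section

open Set Filter Topology Function

namespace Summit.FinalStateConjecture.FinalStateConjecture.Theorems

variable {Y M : Type*}

/-- **Existence of a crossing.** If `F y` is continuous, tends to `+∞`, and `F y t₁ < σ`, then
`F y t = σ` for some `t ≥ t₁` (intermediate value theorem). [folklore] -/
theorem exists_crossing (F : Y → ℝ → ℝ) (hc : ∀ y, Continuous (F y))
    (htop : ∀ y, Tendsto (F y) atTop atTop) {t₁ σ : ℝ} (hlt : ∀ y, F y t₁ < σ) (y : Y) :
    ∃ t, t₁ ≤ t ∧ F y t = σ := by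
  obtain ⟨t₂, ht₂σ, ht₁₂⟩ :=
    (((htop y).eventually_ge_atTop σ).and (eventually_ge_atTop t₁)).exists
  have hmem : σ ∈ Icc (F y t₁) (F y t₂) := ⟨(hlt y).le, ht₂σ⟩
  obtain ⟨t, ht, hft⟩ := intermediate_value_Icc ht₁₂ (hc y).continuousOn hmem
  exact ⟨t, ht.1, hft⟩

/-- **The crossing time** `tσ y`: some `t ≥ t₁` with `F y t = σ` (unique by `crossing_unique`).
[folklore] -/
def crossing (F : Y → ℝ → ℝ) (hc : ∀ y, Continuous (F y))
    (htop : ∀ y, Tendsto (F y) atTop atTop) {t₁ σ : ℝ} (hlt : ∀ y, F y t₁ < σ) (y : Y) : ℝ :=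
  (exists_crossing F hc htop hlt y).choose

/-- The crossing time solves `F y t = σ`. [folklore] -/
theorem crossing_spec (F : Y → ℝ → ℝ) (hc : ∀ y, Continuous (F y))
    (htop : ∀ y, Tendsto (F y) atTop atTop) {t₁ σ : ℝ} (hlt : ∀ y, F y t₁ < σ) (y : Y) :
    F y (crossing F hc htop hlt y) = σ :=
  (exists_crossing F hc htop hlt y).choose_spec.2

/-- The crossing time is not earlier than `t₁`. [folklore] -/
theorem le_crossing (F : Y → ℝ → ℝ) (hc : ∀ y, Continuous (F y))
    (htop : ∀ y, Tendsto (F y) atTop atTop) {t₁ σ : ℝ} (hlt : ∀ y, F y t₁ < σ) (y : Y) :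
    t₁ ≤ crossing F hc htop hlt y :=
  (exists_crossing F hc htop hlt y).choose_spec.1

/-- **Uniqueness of the crossing** along a strictly increasing worldline time. [folklore] -/
theorem crossing_unique (F : Y → ℝ → ℝ) (hc : ∀ y, Continuous (F y))
    (hmono : ∀ y, StrictMono (F y)) (htop : ∀ y, Tendsto (F y) atTop atTop) {t₁ σ : ℝ}
    (hlt : ∀ y, F y t₁ < σ) {y : Y} {t : ℝ} (ht : F y t = σ) :
    t = crossing F hc htop hlt y :=
  (hmono y).injective (ht.trans (crossing_spec F hc htop hlt y).symm)

section Topology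

variable [TopologicalSpace Y]

/-- **Continuity of the crossing time** in the base point, from JOINT continuity of `(y, t) ↦ F y t`
and strict monotonicity in `t` (an order-theoretic implicit function theorem). [folklore] -/
theorem continuous_crossing (F : Y → ℝ → ℝ) (hF : Continuous (uncurry F))
    (hmono : ∀ y, StrictMono (F y)) (htop : ∀ y, Tendsto (F y) atTop atTop) {t₁ σ : ℝ}
    (hlt : ∀ y, F y t₁ < σ) :
    Continuous (crossing F (fun y ↦ hF.comp (Continuous.prodMk_right y)) htop hlt) := by
  set hc : ∀ y, Continuous (F y) := fun y ↦ hF.comp (Continuous.prodMk_right y)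
  have hsec : ∀ a : ℝ, Continuous fun y ↦ F y a := fun a ↦ hF.comp (Continuous.prodMk_left a)
  refine continuous_iff_continuousAt.2 fun y₀ ↦ ?_
  rw [ContinuousAt, tendsto_order]
  refine ⟨fun a ha ↦ ?_, fun a ha ↦ ?_⟩
  · -- below the crossing time the worldline is below the leaf, and this is an open condition in `y`
    have h1 : F y₀ a < σ := by
      have := hmono y₀ ha
      rwa [crossing_spec F hc htop hlt y₀] at this
    have h2 : ∀ᶠ y in 𝓝 y₀, F y a < σ := ((hsec a).tendsto y₀).eventually_lt_const h1
    refine h2.mono fun y hy ↦ ?_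
    by_contra hle
    push Not at hle
    have hmon := (hmono y).monotone hle
    rw [crossing_spec F hc htop hlt y] at hmon
    exact absurd (lt_of_le_of_lt hmon hy) (lt_irrefl _)
  · have h1 : σ < F y₀ a := by
      have := hmono y₀ ha
      rwa [crossing_spec F hc htop hlt y₀] at this
    have h2 : ∀ᶠ y in 𝓝 y₀, σ < F y a := ((hsec a).tendsto y₀).eventually_const_lt h1
    refine h2.mono fun y hy ↦ ?_
    by_contra hle
    push Not at hle
    have hmon := (hmono y).monotone hle
    rw [crossing_spec F hc htop hlt y] at hmon
    exact absurd (lt_of_lt_of_le hy hmon) (lt_irrefl _)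

/-- **The leaf section** `y ↦ c y (tσ y)` of the level set `{f = σ}` along a congruence `c` on which
`f` is a time function. [folklore] -/
def leafSection (f : M → ℝ) (c : Y → ℝ → M) (hfc : Continuous (uncurry fun y t ↦ f (c y t)))
    (htop : ∀ y, Tendsto (fun t ↦ f (c y t)) atTop atTop) {t₁ σ : ℝ}
    (hlt : ∀ y, f (c y t₁) < σ) (y : Y) : M :=
  c y (crossing (fun y t ↦ f (c y t)) (fun y ↦ hfc.comp (Continuous.prodMk_right y)) htop hlt y)

/-- The leaf section lies in the leaf `{f = σ}`. [folklore] -/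
theorem leafSection_level (f : M → ℝ) (c : Y → ℝ → M)
    (hfc : Continuous (uncurry fun y t ↦ f (c y t)))
    (htop : ∀ y, Tendsto (fun t ↦ f (c y t)) atTop atTop) {t₁ σ : ℝ}
    (hlt : ∀ y, f (c y t₁) < σ) (y : Y) :
    f (leafSection f c hfc htop hlt y) = σ :=
  crossing_spec (fun y t ↦ f (c y t)) _ htop hlt y

/-- The leaf section is reached after the initial time `t₁`. [folklore] -/
theorem leafSection_mem_image (f : M → ℝ) (c : Y → ℝ → M)
    (hfc : Continuous (uncurry fun y t ↦ f (c y t)))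
    (htop : ∀ y, Tendsto (fun t ↦ f (c y t)) atTop atTop) {t₁ σ : ℝ}
    (hlt : ∀ y, f (c y t₁) < σ) (y : Y) :
    leafSection f c hfc htop hlt y ∈ c y '' Ici t₁ :=
  ⟨_, le_crossing (fun y t ↦ f (c y t)) _ htop hlt y, rfl⟩

/-- **Continuity of the leaf section** (joint continuity of the congruence and of `f ∘ c`, strict
monotonicity of the time function along each worldline). [folklore] -/
theorem continuous_leafSection [TopologicalSpace M] (f : M → ℝ) (c : Y → ℝ → M) (hc : Continuous (uncurry c))
    (hfc : Continuous (uncurry fun y t ↦ f (c y t)))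
    (hmono : ∀ y, StrictMono fun t ↦ f (c y t))
    (htop : ∀ y, Tendsto (fun t ↦ f (c y t)) atTop atTop) {t₁ σ : ℝ}
    (hlt : ∀ y, f (c y t₁) < σ) :
    Continuous (leafSection f c hfc htop hlt) :=
  hc.comp (continuous_id.prodMk (continuous_crossing (fun y t ↦ f (c y t)) hfc hmono htop hlt))

/-- **Injectivity of the leaf section** when distinct worldlines are disjoint (`uncurry c` injective).
[folklore] -/
theorem leafSection_injective (f : M → ℝ) (c : Y → ℝ → M) (hinj : Injective (uncurry c))
    (hfc : Continuous (uncurry fun y t ↦ f (c y t)))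
    (htop : ∀ y, Tendsto (fun t ↦ f (c y t)) atTop atTop) {t₁ σ : ℝ}
    (hlt : ∀ y, f (c y t₁) < σ) :
    Injective (leafSection f c hfc htop hlt) := by
  intro y y' h
  have := hinj (a₁ := (y, _)) (a₂ := (y', _)) h
  exact (Prod.ext_iff.1 this).1

/-- **The leaf `Λ_σ` is a homeomorphic copy of `Y` inside one level set.** For compact `Y` and
Hausdorff `M` the leaf section is a closed embedding with image in `{f = σ}` (CAPS LEMMA A, Step 4:
`N″ ≅ Λ_σ ⊆ {x⁰ = σ}`; Step 5 then reads off `N″ ↪ ℝ³`). [folklore] -/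
theorem isClosedEmbedding_leafSection [TopologicalSpace M] [CompactSpace Y] [T2Space M] (f : M → ℝ) (c : Y → ℝ → M)
    (hc : Continuous (uncurry c)) (hinj : Injective (uncurry c))
    (hfc : Continuous (uncurry fun y t ↦ f (c y t)))
    (hmono : ∀ y, StrictMono fun t ↦ f (c y t))
    (htop : ∀ y, Tendsto (fun t ↦ f (c y t)) atTop atTop) {t₁ σ : ℝ}
    (hlt : ∀ y, f (c y t₁) < σ) :
    IsClosedEmbedding (leafSection f c hfc htop hlt) ∧
      range (leafSection f c hfc htop hlt) ⊆ f ⁻¹' {σ} :=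
  ⟨(continuous_leafSection f c hc hfc hmono htop hlt).isClosedEmbedding
      (leafSection_injective f c hinj hfc htop hlt),
    by rintro _ ⟨y, rfl⟩; exact leafSection_level f c hfc htop hlt y⟩

end Topology

end Summit.FinalStateConjecture.FinalStateConjecture.Theorems
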